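import Summits.ValiantsHypothesis.ValiantsHypothesis.Theorems.BarrierLeverDefinableEquationsUnipotentElementary

/-!
# Cruxes `BarrierLever.DefinableEquations` (8745) / `SingleSizeEquations` (8749) — the GENERIC
# UNIPOTENT TRANSLATE `G(s, c) = E(T_s c)` is a `poly(N)`-size Boolean sum in `(s, c)`

Fourth file of the "U-half" of the normal-form programme (design memo `HWV-NORMAL-FORM-PLAN.md`,
evidence #9 on stmt-ValiantsHypothesis-8749).  For a Boolean-sum datum `H ∈ ℂ[c ⊕ e]` of
`E = boolSum H` (coefficient variables `c_m`, `|m| ≤ n`, `N = C(2n,n)` of them) we build the datum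

  `H_G := Ψ_{pairList} (H)`  in the variables `(s ⊕ c) ⊕ e`,  `s = (s_ij)` the `n²` group parameters,

by substituting, root by root along `pairList` (`…UnipotentElementary.lean`), the explicit
coefficient action of the elementary unipotent `e_ij(s_ij)` for the `c`-variables (`stepSubst`:
`c_m ↦ Σ_{k ≤ m_i} C(m_j + k, k) s_ij^k c_{m - kε_i + kε_j}`, the `s`- and `e`-variables fixed).
THEOREMS.  `eval_boolSum_genTranslate`: `boolSum H_G (s, c) = E(T_s c)` for all `s, c` (the
coefficient action of the full unitriangular substitution `u_s`, by `aeval_unip_eq_compU`);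
`complexity_genTranslate_le`: `L(H_G) ≤ L(H) + n² · N (n+1)(n+3)` (the substitutions are applied to
ONE polynomial, so the cost is additive — this is where single-output circuit size suffices for a
joint computation); `totalDegree_genTranslate_le`: `deg H_G ≤ deg H · (1 + n³)` (the images
`Ψ_ℓ(c_m)` have degree `≤ 1 + |ℓ| n`: additive, not multiplicative, growth — `totalDegree_genHomH_X_le`).

Elementary; small definitions (`shiftMon`, `stepSubst`, `spt`, `stepSubstH`, `genHomH` abbreviate
explicit expressions), no named facts.  HONEST FRAMING: infrastructure for a normal form; nothing
here bears on the open content of the cruxes.  References: [Burgisser2000] §2.1, Rem. 2.7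
(substitution and Boolean sums); [ForbesShpilkaVolk2018] Def. 1 (frame).
-/

-- layout Summits/ValiantsHypothesis/ValiantsHypothesis forces the duplicated namespace component
set_option linter.dupNamespace false

noncomputable section

open MvPolynomial

namespace Summit.ValiantsHypothesis.ValiantsHypothesis.Theorems.BarrierLever.IsobaricEquations

open Literature.Computability.AlgebraicComplexity Literature.Barriers.ValiantsHypothesis

variable {n : ℕ}

/-! ## §5 The generic translate `G(s, c) = E(T_s c)` as an iterated cheap substitution -/

section generic

/-- Shifting an exponent `m ↦ m - kε_i + kε_j` (`k ≤ m_i`) inside the monomials of degree `≤ n`.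
[folklore] -/
theorem shift_mem (m : degLEMonomials n) (i j : Fin n) (k : ℕ) (hk : k ≤ (m : Fin n →₀ ℕ) i) :
    (m : Fin n →₀ ℕ) - Finsupp.single i k + Finsupp.single j k ∈ degLEMonomials n := by
  have hm := m.2
  simp only [degLEMonomials, Set.mem_setOf_eq] at hm ⊢
  have hle : Finsupp.single i k ≤ (m : Fin n →₀ ℕ) := Finsupp.single_le_iff.mpr hk
  have hsplit := tsub_add_cancel_of_le hle
  have hdeg : ((m : Fin n →₀ ℕ) - Finsupp.single i k).degree + k = (m : Fin n →₀ ℕ).degree := by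
    conv_rhs => rw [← hsplit]
    rw [map_add, Finsupp.degree_single]
  rw [map_add, Finsupp.degree_single]
  omega

/-- The shifted exponent as a member of `degLEMonomials n`. [folklore] -/
def shiftMon (m : degLEMonomials n) (i j : Fin n) (k : Fin ((m : Fin n →₀ ℕ) i + 1)) :
    degLEMonomials n :=
  ⟨(m : Fin n →₀ ℕ) - Finsupp.single i (k : ℕ) + Finsupp.single j (k : ℕ),
    shift_mem m i j k (Nat.lt_succ_iff.mp k.2)⟩

/-- **One elementary step as a substitution** in the variables `s ⊕ c` (the `s`-variables fixed,
`c_m ↦ Σ_{k ≤ m_i} C(m_j + k, k) s_p^k c_{m - kε_i + kε_j}` for the root `p = (i, j)`).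
[cite: Burgisser2000, Rem. 2.7] -/
def stepSubst (p : Fin n × Fin n) :
    (Fin n × Fin n) ⊕ degLEMonomials n → MvPolynomial ((Fin n × Fin n) ⊕ degLEMonomials n) ℂ
  | Sum.inl p' => X (Sum.inl p')
  | Sum.inr m => ∑ k : Fin ((m : Fin n →₀ ℕ) p.1 + 1),
      C ((((m : Fin n →₀ ℕ) p.2 + k).choose k : ℕ) : ℂ) * X (Sum.inl p) ^ (k : ℕ) *
        X (Sum.inr (shiftMon m p.1 p.2 k))

/-- The evaluation point `(s, c)`. [folklore] -/
def spt (s : Fin n → Fin n → ℂ) (c : degLEMonomials n → ℂ) : (Fin n × Fin n) ⊕ degLEMonomials n → ℂ :=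
  Sum.elim (fun p => s p.1 p.2) c

/-- **Semantics of one step**: at the point `(s, c)` the step substitution for the root `(i, j)`,
`i ≠ j`, evaluates to the coefficient vector of `f_c ∘ e_ij(s_ij)`. [folklore] -/
theorem eval_stepSubst_inr [Fintype (degLEMonomials n)] {p : Fin n × Fin n} (hp : p.1 ≠ p.2) (s : Fin n → Fin n → ℂ)
    (c : degLEMonomials n → ℂ) (m : degLEMonomials n) :
    eval (spt s c) (stepSubst p (Sum.inr m)) =
      coeff (m : Fin n →₀ ℕ) (aeval (elemU p.1 p.2 (s p.1 p.2)) (ofCoeffs c)) := by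
  rw [coeff_aeval_elemU hp, stepSubst, map_sum, ← Fin.sum_univ_eq_sum_range]
  refine Finset.sum_congr rfl fun k _ => ?_
  simp only [map_mul, map_pow, eval_X, spt, Sum.elim_inl, Sum.elim_inr, map_natCast]
  congr 1
  exact (coeff_ofCoeffs c (shiftMon m p.1 p.2 k)).symm

/-- The step substitution fixes the `s`-variables. [folklore] -/
theorem eval_stepSubst_inl (p p' : Fin n × Fin n) (s : Fin n → Fin n → ℂ) (c : degLEMonomials n → ℂ) :
    eval (spt s c) (stepSubst p (Sum.inl p')) = s p'.1 p'.2 := by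
  rw [stepSubst, eval_X, spt, Sum.elim_inl]

/-- **Evaluating after one step** = evaluating at the transformed coefficient vector. [folklore] -/
theorem eval_aeval_stepSubst [Fintype (degLEMonomials n)] {p : Fin n × Fin n} (hp : p.1 ≠ p.2) (s : Fin n → Fin n → ℂ)
    (c : degLEMonomials n → ℂ) (P : MvPolynomial ((Fin n × Fin n) ⊕ degLEMonomials n) ℂ) :
    eval (spt s c) (aeval (stepSubst p) P) =
      eval (spt s (coeffVector (degLEMonomials n) (aeval (elemU p.1 p.2 (s p.1 p.2)) (ofCoeffs c))))
        P := by
  have hpt : (fun v => eval (spt s c) (stepSubst p v)) =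
      spt s (coeffVector (degLEMonomials n) (aeval (elemU p.1 p.2 (s p.1 p.2)) (ofCoeffs c))) := by
    funext v
    rcases v with p' | m
    · rw [eval_stepSubst_inl, spt, Sum.elim_inl]
    · rw [eval_stepSubst_inr hp, spt, Sum.elim_inr, coeffVector_apply]
  rw [BoolSumComponents.eval_aeval_eq, hpt]

/-- The composite of elementary substitutions does not raise the degree. [folklore] -/
theorem totalDegree_compU_le (s : Fin n → Fin n → ℂ) :
    ∀ (ℓ : List (Fin n × Fin n)) (g : MvPolynomial (Fin n) ℂ),
      (compU s ℓ g).totalDegree ≤ g.totalDegree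
  | [], g => le_rfl
  | p :: ℓ, g => by
    rw [compU_cons]
    exact (totalDegree_aeval_affine_le _ (elemUnipotent_affine p.1 p.2 (s p.1 p.2)) _).trans
      (totalDegree_compU_le s ℓ g)

/-- The lifted step on the Boolean-sum datum (Boolean variables fixed). [folklore] -/
def stepSubstH (q : ℕ) (p : Fin n × Fin n) :
    ((Fin n × Fin n) ⊕ degLEMonomials n) ⊕ Fin q →
      MvPolynomial (((Fin n × Fin n) ⊕ degLEMonomials n) ⊕ Fin q) ℂ :=
  Sum.elim (fun v => rename Sum.inl (stepSubst p v)) (fun j => X (Sum.inr j))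

/-- **The iterated substitution on the Boolean-sum datum** along a list of roots (head = outermost,
applied LAST to the datum): `Ψ_{p :: ℓ} = Ψ_ℓ ∘ θ_p`. [cite: Burgisser2000, Rem. 2.7] -/
def genHomH (q : ℕ) : List (Fin n × Fin n) →
    (MvPolynomial (((Fin n × Fin n) ⊕ degLEMonomials n) ⊕ Fin q) ℂ →ₐ[ℂ]
      MvPolynomial (((Fin n × Fin n) ⊕ degLEMonomials n) ⊕ Fin q) ℂ)
  | [] => AlgHom.id ℂ _
  | p :: ℓ => (genHomH q ℓ).comp (aeval (stepSubstH q p))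

/-- Unfolding `genHomH` on a cons. [folklore] -/
theorem genHomH_cons (q : ℕ) (p : Fin n × Fin n) (ℓ : List (Fin n × Fin n))
    (H : MvPolynomial (((Fin n × Fin n) ⊕ degLEMonomials n) ⊕ Fin q) ℂ) :
    genHomH q (p :: ℓ) H = genHomH q ℓ (aeval (stepSubstH q p) H) := rfl

/-- **Semantics of the iterated substitution**: the Boolean sum of `Ψ_ℓ H` at `(s, c)` is the
Boolean sum of `H` at `(s, coeff(U_ℓ f_c))`, `U_ℓ` the composite of the elementary substitutions.
[folklore] -/
theorem eval_boolSum_genHomH [Fintype (degLEMonomials n)] {q : ℕ} (s : Fin n → Fin n → ℂ) :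
    ∀ (ℓ : List (Fin n × Fin n)), (∀ p ∈ ℓ, p.1 < p.2) →
      ∀ (H : MvPolynomial (((Fin n × Fin n) ⊕ degLEMonomials n) ⊕ Fin q) ℂ)
        (c : degLEMonomials n → ℂ),
        eval (spt s c) (boolSum (genHomH q ℓ H)) =
          eval (spt s (coeffVector (degLEMonomials n) (compU s ℓ (ofCoeffs c)))) (boolSum H)
  | [], _, H, c => by
    show eval (spt s c) (boolSum H) = _
    rw [show compU s [] (ofCoeffs c) = ofCoeffs c from rfl, coeffVector_ofCoeffs]
  | p :: ℓ, hℓ, H, c => by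
    have hp : p.1 ≠ p.2 := Fin.ne_of_lt (hℓ p List.mem_cons_self)
    rw [genHomH_cons, eval_boolSum_genHomH s ℓ (fun p' hp' => hℓ p' (List.mem_cons_of_mem _ hp')),
      stepSubstH, BoolSumComponents.boolSum_aeval_inl, eval_aeval_stepSubst hp, compU_cons]
    congr 2
    rw [ofCoeffs_coeffVector _ ((totalDegree_compU_le s ℓ _).trans (totalDegree_ofCoeffs_le c))]

/-- **The generic translate.** For the datum `H` of `E = boolSum H`, the datum
`H_G := Ψ_{pairList} (H renamed into the variables s ⊕ c)` has Boolean sum `G` with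
`G(s, c) = E(T_s c)` for all `s, c`. [cite: Burgisser2000, Rem. 2.7] -/
theorem eval_boolSum_genTranslate [Fintype (degLEMonomials n)] {q : ℕ} (H : MvPolynomial (degLEMonomials n ⊕ Fin q) ℂ)
    (s : Fin n → Fin n → ℂ) (c : degLEMonomials n → ℂ) :
    eval (spt s c) (boolSum (genHomH q (pairList n) (rename (Sum.map Sum.inr id) H))) =
      eval (uAct s c) (boolSum H) := by
  rw [eval_boolSum_genHomH s (pairList n) (fun p hp => mem_pairList.mp hp), boolSum_rename_sumMap,
    eval_rename, ← aeval_unip_eq_compU]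
  rfl

end generic

/-! ## §6 Size and degree of the generic translate -/

section size

/-- `L(x^e) ≤ e`. [cite: Burgisser2000, §2.1] -/
theorem complexity_Xpow_le {σ : Type*} (v : σ) : ∀ e : ℕ, complexity (X v ^ e : MvPolynomial σ ℂ) ≤ e
  | 0 => by rw [pow_zero, ← C_1]; exact (complexity_C_holds (1 : ℂ)).le
  | e + 1 => by
    rw [pow_succ]
    refine (complexity_mul_le_holds _ _).trans ?_
    rw [complexity_X_holds]
    have := complexity_Xpow_le v e
    omega

/-- Size of one entry of the step substitution: `≤ (n+1)(n+3)`. [cite: Burgisser2000, §2.1] -/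
theorem complexity_stepSubst_inr_le (p : Fin n × Fin n) (m : degLEMonomials n) :
    complexity (stepSubst p (Sum.inr m)) ≤ (n + 1) * (n + 3) := by
  have hmi : (m : Fin n →₀ ℕ) p.1 ≤ n := by
    have hm := m.2
    simp only [degLEMonomials, Set.mem_setOf_eq] at hm
    exact (Finsupp.le_degree p.1 (m : Fin n →₀ ℕ)).trans hm
  rw [stepSubst]
  refine (complexity_finset_sum_le _ _).trans ?_
  rw [Finset.card_univ, Fintype.card_fin]
  have hterm : ∀ k : Fin ((m : Fin n →₀ ℕ) p.1 + 1),
      complexity (C ((((m : Fin n →₀ ℕ) p.2 + k).choose k : ℕ) : ℂ) * X (Sum.inl p) ^ (k : ℕ) *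
        X (Sum.inr (shiftMon m p.1 p.2 k)) :
          MvPolynomial ((Fin n × Fin n) ⊕ degLEMonomials n) ℂ) ≤ n + 2 := by
    intro k
    have hk : (k : ℕ) ≤ n := (Nat.lt_succ_iff.mp k.2).trans hmi
    have h1 := complexity_mul_le_holds
      (C ((((m : Fin n →₀ ℕ) p.2 + k).choose k : ℕ) : ℂ) * X (Sum.inl p) ^ (k : ℕ) :
        MvPolynomial ((Fin n × Fin n) ⊕ degLEMonomials n) ℂ) (X (Sum.inr (shiftMon m p.1 p.2 k)))
    have h2 := complexity_mul_le_holds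
      (C ((((m : Fin n →₀ ℕ) p.2 + k).choose k : ℕ) : ℂ) :
        MvPolynomial ((Fin n × Fin n) ⊕ degLEMonomials n) ℂ) (X (Sum.inl p) ^ (k : ℕ))
    have h3 := complexity_Xpow_le (σ := (Fin n × Fin n) ⊕ degLEMonomials n) (Sum.inl p) (k : ℕ)
    rw [complexity_X_holds] at h1
    rw [complexity_C_holds] at h2
    omega
  calc ∑ k : Fin ((m : Fin n →₀ ℕ) p.1 + 1), complexity
        (C ((((m : Fin n →₀ ℕ) p.2 + k).choose k : ℕ) : ℂ) * X (Sum.inl p) ^ (k : ℕ) *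
          X (Sum.inr (shiftMon m p.1 p.2 k)) :
            MvPolynomial ((Fin n × Fin n) ⊕ degLEMonomials n) ℂ) + ((m : Fin n →₀ ℕ) p.1 + 1)
      ≤ ∑ _k : Fin ((m : Fin n →₀ ℕ) p.1 + 1), (n + 2) + (n + 1) :=
        Nat.add_le_add (Finset.sum_le_sum fun k _ => hterm k) (by omega)
    _ = ((m : Fin n →₀ ℕ) p.1 + 1) * (n + 2) + (n + 1) := by
        rw [Finset.sum_const, Finset.card_univ, Fintype.card_fin, smul_eq_mul]
    _ ≤ (n + 1) * (n + 2) + (n + 1) := Nat.add_le_add_right (Nat.mul_le_mul_right _ (by omega)) _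
    _ = (n + 1) * (n + 3) := by ring

/-- Size of one full step on the datum: `L(θ_p H) ≤ L(H) + N (n+1)(n+3)`. [cite: Burgisser2000, Rem. 2.7] -/
theorem complexity_aeval_stepSubstH_le [Fintype (degLEMonomials n)] {q : ℕ} (p : Fin n × Fin n)
    (H : MvPolynomial (((Fin n × Fin n) ⊕ degLEMonomials n) ⊕ Fin q) ℂ) :
    complexity (aeval (stepSubstH q p) H) ≤
      complexity H + Fintype.card (degLEMonomials n) * ((n + 1) * (n + 3)) := by
  refine (complexity_aeval_le _ _).trans (Nat.add_le_add_left ?_ _)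
  rw [Fintype.sum_sum_type, Fintype.sum_sum_type]
  have h1 : ∑ p' : Fin n × Fin n, complexity (stepSubstH q p (Sum.inl (Sum.inl p'))) = 0 :=
    Finset.sum_eq_zero fun p' _ => by
      rw [stepSubstH, Sum.elim_inl, stepSubst, rename_X]; exact complexity_X_holds _
  have h3 : ∑ j : Fin q, complexity (stepSubstH q p (Sum.inr j)) = 0 :=
    Finset.sum_eq_zero fun j _ => by rw [stepSubstH, Sum.elim_inr]; exact complexity_X_holds _
  rw [h1, h3, zero_add, add_zero]
  calc ∑ m : degLEMonomials n, complexity (stepSubstH q p (Sum.inl (Sum.inr m)))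
      ≤ ∑ _m : degLEMonomials n, (n + 1) * (n + 3) := Finset.sum_le_sum fun m _ => by
        rw [stepSubstH, Sum.elim_inl]
        exact (complexity_rename_le_holds' _ _).trans (complexity_stepSubst_inr_le p m)
    _ = Fintype.card (degLEMonomials n) * ((n + 1) * (n + 3)) := by
        rw [Finset.sum_const, Finset.card_univ, smul_eq_mul]

/-- **Size of the iterated substitution**: `L(Ψ_ℓ H) ≤ L(H) + |ℓ| · N (n+1)(n+3)`.
[cite: Burgisser2000, Rem. 2.7] -/
theorem complexity_genHomH_le [Fintype (degLEMonomials n)] {q : ℕ} :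
    ∀ (ℓ : List (Fin n × Fin n)) (H : MvPolynomial (((Fin n × Fin n) ⊕ degLEMonomials n) ⊕ Fin q) ℂ),
      complexity (genHomH q ℓ H) ≤
        complexity H + ℓ.length * (Fintype.card (degLEMonomials n) * ((n + 1) * (n + 3)))
  | [], H => by simp [genHomH]
  | p :: ℓ, H => by
    rw [genHomH_cons, List.length_cons]
    refine (complexity_genHomH_le ℓ _).trans ?_
    have := complexity_aeval_stepSubstH_le p H
    generalize Fintype.card (degLEMonomials n) * ((n + 1) * (n + 3)) = K at this ⊢
    rw [Nat.succ_mul]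
    omega

/-- The iterated substitution fixes the `s`-variables. [folklore] -/
theorem genHomH_X_inl_inl {q : ℕ} (p' : Fin n × Fin n) :
    ∀ ℓ : List (Fin n × Fin n), genHomH (n := n) q ℓ (X (Sum.inl (Sum.inl p'))) = X (Sum.inl (Sum.inl p'))
  | [] => rfl
  | p :: ℓ => by rw [genHomH_cons, aeval_X, stepSubstH, Sum.elim_inl, stepSubst, rename_X,
      genHomH_X_inl_inl p' ℓ]

/-- The iterated substitution fixes the Boolean variables. [folklore] -/
theorem genHomH_X_inr {q : ℕ} (j : Fin q) :
    ∀ ℓ : List (Fin n × Fin n), genHomH (n := n) q ℓ (X (Sum.inr j)) = X (Sum.inr j)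
  | [] => rfl
  | p :: ℓ => by rw [genHomH_cons, aeval_X, stepSubstH, Sum.elim_inr, genHomH_X_inr j ℓ]

/-- `deg (C a · x_v^k · P) ≤ k + deg P`. [folklore] -/
theorem totalDegree_C_mul_X_pow_mul_le {σ : Type*} (a : ℂ) (v : σ) (k : ℕ) (P : MvPolynomial σ ℂ) :
    (C a * X v ^ k * P).totalDegree ≤ k + P.totalDegree := by
  refine (totalDegree_mul _ _).trans (Nat.add_le_add_right ?_ _)
  refine (totalDegree_mul _ _).trans ?_
  rw [totalDegree_C, zero_add]
  exact (totalDegree_pow _ _).trans (by rw [totalDegree_X, mul_one])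

/-- **Degree of the images of the coefficient variables**: `deg Ψ_ℓ(c_m) ≤ 1 + |ℓ| · n` (each step
adds at most `n` to the `s`-degree; no multiplicative blow-up). [folklore] -/
theorem totalDegree_genHomH_X_le {q : ℕ} (ℓ : List (Fin n × Fin n)) :
    ∀ m : degLEMonomials n,
      (genHomH (n := n) q ℓ (X (Sum.inl (Sum.inr m)))).totalDegree ≤ 1 + ℓ.length * n := by
  induction ℓ with
  | nil =>
    intro m
    rw [show genHomH (n := n) q [] (X (Sum.inl (Sum.inr m))) = X (Sum.inl (Sum.inr m)) from rfl,
      totalDegree_X]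
    omega
  | cons p ℓ ih =>
    intro m
    have hmi : (m : Fin n →₀ ℕ) p.1 ≤ n := by
      have hm := m.2
      simp only [degLEMonomials, Set.mem_setOf_eq] at hm
      exact (Finsupp.le_degree p.1 (m : Fin n →₀ ℕ)).trans hm
    rw [genHomH_cons, aeval_X, stepSubstH, Sum.elim_inl, stepSubst, map_sum, map_sum,
      List.length_cons]
    refine totalDegree_finsetSum_le fun k _ => ?_
    have hk : (k : ℕ) ≤ n := (Nat.lt_succ_iff.mp k.2).trans hmi
    rw [map_mul, map_mul, map_mul, map_mul, map_pow, map_pow, rename_C, rename_X, rename_X, algHom_C,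
      genHomH_X_inl_inl]
    refine (totalDegree_C_mul_X_pow_mul_le _ _ _ _).trans ?_
    have h4 := ih (shiftMon m p.1 p.2 k)
    rw [Nat.succ_mul]
    generalize ℓ.length * n = T at h4 ⊢
    omega

/-- **Size of the generic-translate datum**: `L(H_G) ≤ L(H) + n² · N (n+1)(n+3)`.
[cite: Burgisser2000, Rem. 2.7] -/
theorem complexity_genTranslate_le [Fintype (degLEMonomials n)] {q : ℕ} (H : MvPolynomial (degLEMonomials n ⊕ Fin q) ℂ) :
    complexity (genHomH q (pairList n) (rename (Sum.map Sum.inr id) H)) ≤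
      complexity H + n * n * (Fintype.card (degLEMonomials n) * ((n + 1) * (n + 3))) := by
  refine (complexity_genHomH_le _ _).trans ?_
  exact Nat.add_le_add (complexity_rename_le_holds' _ _)
    (Nat.mul_le_mul_right _ length_pairList_le)

/-- **Degree of the generic-translate datum**: `deg H_G ≤ deg H · (1 + n³)`. [folklore] -/
theorem totalDegree_genTranslate_le {q : ℕ} (H : MvPolynomial (degLEMonomials n ⊕ Fin q) ℂ) :
    (genHomH q (pairList n) (rename (Sum.map Sum.inr id) H)).totalDegree ≤
      H.totalDegree * (1 + n * n * n) := by
  rw [aeval_unique (genHomH q (pairList n))]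
  rw [show aeval ((genHomH q (pairList n) : _ → _) ∘ X) (rename (Sum.map Sum.inr id) H) =
      bind₁ ((genHomH q (pairList n) : _ → _) ∘ X) (rename (Sum.map Sum.inr id) H) from rfl]
  refine (Literature.Barriers.ValiantsHypothesis.FSV2018.totalDegree_bind₁_le_mul _ (1 + n * n * n)
    (fun v => ?_) _).trans (Nat.mul_le_mul_right _ (totalDegree_rename_le _ _))
  have hlen : (pairList n).length * n ≤ n * n * n := Nat.mul_le_mul_right _ length_pairList_le
  rcases v with (p' | m) | j
  · rw [Function.comp_apply, genHomH_X_inl_inl, totalDegree_X]; omega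
  · exact (totalDegree_genHomH_X_le _ m).trans (by omega)
  · rw [Function.comp_apply, genHomH_X_inr, totalDegree_X]; omega

end size

end Summit.ValiantsHypothesis.ValiantsHypothesis.Theorems.BarrierLever.IsobaricEquations

end
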